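import Mathlib
import Literature.NumberTheory.Automorphic.HilbertModularFormQExpansion
import Summits.Langlands.Langlands.Theorems.CapacityClassicalityHilbertIntegralOverconvergentIsCongruenceEngineInstanceData
import Summits.Langlands.Langlands.Theorems.CapacityClassicalityHilbertIntegralOverconvergentIsCongruenceStubConeClassMul
import Summits.Langlands.Langlands.Theorems.CapacityClassicalityHilbertIntegralOverconvergentIsCongruenceStubConeClassLinear
import Summits.Langlands.Langlands.Theorems.CapacityClassicalityHilbertIntegralOverconvergentIsCongruenceStubConeClassOne

/-!
# Relation ⇒ functions: a formal relation among encoded `q`-expansions is a relation among the functions (section S endpoint)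

Endpoint of RESHAPE 15 (section S) of line Sketch-ideate-r1-k1 for the crux `HilbertIntegralOverconvergentIsCongruence`
(stmt-Langlands-8485): `relationToFunctions` — for an admissible encoding `(idx, enc)` (injective and additive on the cone; `enc f`
encodes `fourierCoeff f` for every `f` — the data exposed by `traceEngineFamily`) and functions `φ_u`, `γ` of the CONE CLASS
(holomorphic on `ℍ`, `𝓞 F`-periodic on `ℍ`, Fourier coefficients supported on `qIndexSet F`): if
`∑_u P_u • (enc φ_u * (enc γ)^{j_u}) = 0` in `MvPowerSeries (Fin d) ℂ`, then `∑_u P_u φ_u(z) γ(z)^{j_u} = 0` for every `z ∈ ℍ`.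
Proof: on the cone class `enc` respects products (`eid_dict_of_idx`), linear combinations and `1` (uniqueness of encodings; the class
is closed under these operations: `stub_coneClass_mul`, `stub_coneClass_linear`, `stub_coneClass_one`), so the relation function
`R := ∑_u P_u φ_u γ^{j_u}` has `enc R = enc 0`; injectivity of the `q`-expansion on the class (`stub_qExpansion_injective`) gives
`R = 0` on `ℍ`.  This converts the output of the algebraization engine (a formal relation) into the hypothesis of
`algebraicIsModular` / `qSeries_mem_modularForms_of_algebraic`.
-/

set_option linter.dupNamespace false

noncomputable section

namespace Summit.Langlands.Langlands.Theorems.HilbertIntegralOverconvergentIsCongruence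

open MeasureTheory Complex NumberField
open Literature.NumberTheory.Automorphic Literature.NumberTheory.Automorphic.HilbertModular

/-- **Relation ⇒ functions**: see the module docstring. [folklore] -/
theorem relationToFunctions (F : Type) [Field F] [NumberField F] [NumberField.IsTotallyReal F] (d : ℕ)
    (idx : F → (Fin d →₀ ℕ)) (hinj : Set.InjOn idx (qIndexSet F))
    (hadd : ∀ μ ∈ qIndexSet F, ∀ μ' ∈ qIndexSet F, idx (μ + μ') = idx μ + idx μ')
    (enc : (Point F → ℂ) → MvPowerSeries (Fin d) ℂ)
    (henc : ∀ f : Point F → ℂ, (∀ μ ∈ qIndexSet F, MvPowerSeries.coeff (idx μ) (enc f) = fourierCoeff f μ) ∧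
        ∀ n, (∀ μ ∈ qIndexSet F, idx μ ≠ n) → MvPowerSeries.coeff n (enc f) = 0)
    (ι : Type) [Fintype ι] (φ : ι → Point F → ℂ) (γ : Point F → ℂ) (P : ι → ℂ) (j : ι → ℕ)
    (hφ : ∀ u, IsHolomorphicOn F (φ u) ∧
      (∀ (a : 𝓞 F) (z : Point F), z ∈ halfSpace F → φ u (fun σ ↦ z σ + ((σ (a : F) : ℝ) : ℂ)) = φ u z) ∧
      ∀ μ : F, (∀ a : 𝓞 F, ∃ n : ℤ, Algebra.trace ℚ F (μ * a) = n) → μ ∉ qIndexSet F → fourierCoeff (φ u) μ = 0)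
    (hγ : IsHolomorphicOn F γ ∧
      (∀ (a : 𝓞 F) (z : Point F), z ∈ halfSpace F → γ (fun σ ↦ z σ + ((σ (a : F) : ℝ) : ℂ)) = γ z) ∧
      ∀ μ : F, (∀ a : 𝓞 F, ∃ n : ℤ, Algebra.trace ℚ F (μ * a) = n) → μ ∉ qIndexSet F → fourierCoeff γ μ = 0)
    (hrel : ∑ u, P u • (enc (φ u) * enc γ ^ j u) = 0) (z : Point F) (hz : z ∈ halfSpace F) :
    ∑ u, P u * (φ u z * γ z ^ j u) = 0 := by
  classical
  let RtfCone : (Point F → ℂ) → Prop := fun f ↦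
    IsHolomorphicOn F f ∧ (∀ (a : 𝓞 F) (z : Point F), z ∈ halfSpace F → f (fun σ ↦ z σ + ((σ (a : F) : ℝ) : ℂ)) = f z) ∧
      ∀ μ : F, (∀ a : 𝓞 F, ∃ n : ℤ, Algebra.trace ℚ F (μ * a) = n) → μ ∉ qIndexSet F → fourierCoeff f μ = 0
  have hφ' : ∀ u, RtfCone (φ u) := hφ
  have hγ' : RtfCone γ := hγ
  have hdict := eid_dict_of_idx F d idx hinj hadd
  -- uniqueness of encodings
  have enc_ext : ∀ (a : F → ℂ) (Q Q' : MvPowerSeries (Fin d) ℂ),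
      (∀ μ ∈ qIndexSet F, MvPowerSeries.coeff (idx μ) Q = a μ) →
      (∀ n, (∀ μ ∈ qIndexSet F, idx μ ≠ n) → MvPowerSeries.coeff n Q = 0) →
      (∀ μ ∈ qIndexSet F, MvPowerSeries.coeff (idx μ) Q' = a μ) →
      (∀ n, (∀ μ ∈ qIndexSet F, idx μ ≠ n) → MvPowerSeries.coeff n Q' = 0) → Q = Q' := by
    intro a Q Q' hQ hQ0 hQ' hQ'0
    ext n
    by_cases hn : ∃ μ ∈ qIndexSet F, idx μ = n
    · obtain ⟨μ, hμ, rfl⟩ := hn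
      rw [hQ μ hμ, hQ' μ hμ]
    · push Not at hn
      rw [hQ0 n hn, hQ'0 n hn]
  -- `enc` on the cone class: products, linear combinations, powers, one, zero
  have enc_mul : ∀ f g : Point F → ℂ, RtfCone f → RtfCone g → enc (f * g) = enc f * enc g :=
    fun f g hf hg ↦ hdict f g hf.1 hg.1 hf.2.1 hg.2.1 hf.2.2 hg.2.2 (enc f) (enc g) (enc (f * g)) (henc f) (henc g) (henc (f * g))
  have cls_mul : ∀ f g : Point F → ℂ, RtfCone f → RtfCone g → RtfCone (f * g) :=
    fun f g hf hg ↦ stub_coneClass_mul F f g hf.1 hg.1 hf.2.1 hg.2.1 hf.2.2 hg.2.2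
  have cls_lin : ∀ (f g : Point F → ℂ) (c : ℂ), RtfCone f → RtfCone g → RtfCone (f + c • g) :=
    fun f g c hf hg ↦ (stub_coneClass_linear F f g c hf.1 hg.1 hf.2.1 hg.2.1 hf.2.2 hg.2.2).1
  have enc_lin : ∀ (f g : Point F → ℂ) (c : ℂ), RtfCone f → RtfCone g → enc (f + c • g) = enc f + c • enc g := by
    intro f g c hf hg
    obtain ⟨-, hcoef, -⟩ := stub_coneClass_linear F f g c hf.1 hg.1 hf.2.1 hg.2.1 hf.2.2 hg.2.2
    refine enc_ext (fourierCoeff (f + c • g)) _ _ (henc _).1 (henc _).2 (fun μ hμ ↦ ?_) (fun n hn ↦ ?_)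
    · rw [map_add, map_smul, (henc f).1 μ hμ, (henc g).1 μ hμ, smul_eq_mul, hcoef μ hμ.1]
    · rw [map_add, map_smul, (henc f).2 n hn, (henc g).2 n hn, smul_zero, add_zero]
  obtain ⟨h1hol, h1per, h1zero, h1ne⟩ := stub_coneClass_one F
  have cls_one : RtfCone (1 : Point F → ℂ) :=
    ⟨h1hol, h1per, fun μ hμ hμc ↦ h1ne μ hμ fun h0 ↦ hμc (h0 ▸ zero_mem_qIndexSet)⟩
  have hidx0 : idx 0 = 0 := by
    have h := hadd 0 zero_mem_qIndexSet 0 zero_mem_qIndexSet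
    rw [add_zero] at h
    exact left_eq_add.1 h
  have enc_one : enc (1 : Point F → ℂ) = 1 := by
    refine enc_ext (fourierCoeff (1 : Point F → ℂ)) _ _ (henc _).1 (henc _).2 (fun μ hμ ↦ ?_) (fun n hn ↦ ?_)
    · rw [MvPowerSeries.coeff_one]
      by_cases hμ0 : μ = 0
      · subst hμ0; rw [if_pos hidx0, h1zero]
      · have : idx μ ≠ 0 := fun h ↦ hμ0 (hinj hμ zero_mem_qIndexSet (h.trans hidx0.symm))
        rw [if_neg this, h1ne μ hμ.1 hμ0]
    · rw [MvPowerSeries.coeff_one, if_neg]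
      exact fun h0n ↦ hn 0 zero_mem_qIndexSet (hidx0.trans h0n.symm)
  have h0coef : ∀ μ : F, fourierCoeff (0 : Point F → ℂ) μ = 0 := (stub_coneClass_linear F 0 0 0 (differentiableOn_const 0)
    (differentiableOn_const 0) (fun _ _ _ ↦ rfl) (fun _ _ _ ↦ rfl) (fun μ _ _ ↦ by
      exact (stub_coneClass_linear F 1 1 0 h1hol h1hol h1per h1per cls_one.2.2 cls_one.2.2).2.2 μ) (fun μ _ _ ↦ by
      exact (stub_coneClass_linear F 1 1 0 h1hol h1hol h1per h1per cls_one.2.2 cls_one.2.2).2.2 μ)).2.2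
  have cls_zero : RtfCone (0 : Point F → ℂ) :=
    ⟨differentiableOn_const 0, fun _ _ _ ↦ rfl, fun μ _ _ ↦ h0coef μ⟩
  have enc_zero : enc (0 : Point F → ℂ) = 0 :=
    enc_ext (fourierCoeff (0 : Point F → ℂ)) _ _ (henc _).1 (henc _).2 (fun μ _ ↦ by rw [map_zero, h0coef]) (fun n _ ↦ map_zero _)
  have cls_pow : ∀ m : ℕ, RtfCone (γ ^ m) ∧ enc (γ ^ m) = enc γ ^ m := by
    intro m
    induction m with
    | zero => exact ⟨by simpa using cls_one, by rw [pow_zero, pow_zero]; exact enc_one⟩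
    | succ m ih => exact ⟨by rw [pow_succ]; exact cls_mul _ _ ih.1 hγ, by rw [pow_succ, pow_succ, enc_mul _ _ ih.1 hγ, ih.2]⟩
  have cls_term : ∀ u, RtfCone (φ u * γ ^ j u) := fun u ↦ cls_mul _ _ (hφ u) (cls_pow (j u)).1
  have enc_term : ∀ u, enc (φ u * γ ^ j u) = enc (φ u) * enc γ ^ j u := fun u ↦ by
    rw [enc_mul _ _ (hφ u) (cls_pow (j u)).1, (cls_pow (j u)).2]
  -- the relation function and its encoding
  have hsum : ∀ s : Finset ι, RtfCone (∑ u ∈ s, P u • (φ u * γ ^ j u)) ∧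
      enc (∑ u ∈ s, P u • (φ u * γ ^ j u)) = ∑ u ∈ s, P u • enc (φ u * γ ^ j u) := by
    intro s
    induction s using Finset.induction_on with
    | empty => exact ⟨by simpa using cls_zero, by rw [Finset.sum_empty, Finset.sum_empty]; exact enc_zero⟩
    | insert a s ha ih =>
      refine ⟨?_, ?_⟩
      · rw [Finset.sum_insert ha, add_comm]
        exact cls_lin _ _ (P a) ih.1 (cls_term a)
      · rw [Finset.sum_insert ha, Finset.sum_insert ha, add_comm, enc_lin _ _ (P a) ih.1 (cls_term a), ih.2, add_comm]
  obtain ⟨hRcls, hRenc⟩ := hsum Finset.univ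
  have hR0 : enc (∑ u, P u • (φ u * γ ^ j u)) = enc 0 := by
    rw [hRenc, enc_zero, ← hrel]
    exact Finset.sum_congr rfl fun u _ ↦ by rw [enc_term u]
  -- injectivity on the cone class
  have hcoefR : ∀ μ : F, (∀ a : 𝓞 F, ∃ n : ℤ, Algebra.trace ℚ F (μ * a) = n) →
      fourierCoeff (∑ u, P u • (φ u * γ ^ j u)) μ = fourierCoeff (0 : Point F → ℂ) μ := by
    intro μ hμ
    by_cases hμc : μ ∈ qIndexSet F
    · rw [← (henc _).1 μ hμc, ← (henc (0 : Point F → ℂ)).1 μ hμc, hR0]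
    · rw [hRcls.2.2 μ hμ hμc, cls_zero.2.2 μ hμ hμc]
  have hℍ := stub_qExpansion_injective F _ _ hRcls.1
    cls_zero.1 hRcls.2.1 cls_zero.2.1 hcoefR z hz
  simpa [Finset.sum_apply, Pi.smul_apply, Pi.mul_apply, Pi.pow_apply, smul_eq_mul] using hℍ

end Summit.Langlands.Langlands.Theorems.HilbertIntegralOverconvergentIsCongruence
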